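import Summits.QuantumFields.YangMills.Theorems.BalabanLadderUVSeamRecCeilingsFarUVSummable
import Summits.QuantumFields.YangMills.Theorems.BalabanLadderUVSeamRecCeilingsWindowCellLawsThreshold
import Summits.QuantumFields.YangMills.Theorems.BalabanLadderUVSeamRecCeilingsReducedEMIGlueV6
import HarnessLib

/-!
# Crux `UVSeamRec` (stmt-QuantumFields-20043), v5(α) stub `stub_responseMomentsOdd6` (RM), lane B: the REDUCED (EM_I) — doubled joint
# exponential moments of tempered-d1's influence functional — holds on every odd torus for EVERY cutoff schedule `kmax β R ≤ K(β)`,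
# `K(β) → ∞`, with the ABSOLUTE budget `B_I = 6144·e²`

Helper file (`--supports stmt-QuantumFields-20043`) of the width-lever seat `ym-20043-ceilings-p2` (lane B, gen 5); the composition of
`…CeilingsFarUVSummable` (`largeFieldHalf_schedule_farUV`: the far-UV window cell laws at all levels `k ≤ K(β)` with summable weights) with
g3's engine `…CeilingsWindowCellLaws.torusE_exp_two_mul_sum_influence_le_of_windowCellLaws` (p554392: window cell laws + budget ⇒ doubled joint
exponential moments of the influence functionals of a REDUCED cyclically separated cube family) and the level-`0` floor
`…CeilingsWindowCellLawsThreshold.levelZero_activity_eventually_le` (p555011).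

THE THEOREM (`reducedEMI_farUV`).  Fundamental Wilson state of `SU(N)`, block size `b ≥ 11`, threshold schedule with a floor `ε β k ≥ ε₀ > 0`.
There are a level count `K : ℝ → ℕ` with `K β → ∞` and a threshold `β₁ ≥ 1` such that for EVERY cutoff schedule `kmax` with `kmax β R ≤ K β`:
for all `β ≥ β₁`, every odd torus `2L+1`, every REDUCED (`|x i c| ≤ L`) cyclically `2R+4`-separated cube family (`1 ≤ R`, `4R+8 ≤ L`) and every
`T`,  `⟨exp(2 Σ_{i∈T} influenceAt 𝔟 ε kmax β R (q i) (x i)∘lift)⟩_{2L+1,β} ≤ exp(6144·e²·#T)`.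
`reducedEMI_farUV_SU2` is the same in the letters of the hypothesis `hEMIred` of p556228
`TemperedResponse.responseMomentsOdd6SU2_of_splitCl_gaussianDomination_reducedEMI` (two idle guards added), for every `ℓ₁`; and
`responseMomentsOdd6SU2_of_splitClFarUV_gaussianDomination` records the exact residual of the v6/v7 architecture once the large-field half is
discharged this way: (split-cl) AT A FAR-UV CUTOFF `kmax β R ≤ K β` + (GD) ⇒ `ResponseMomentsOdd6SU2` (no WCL, no ΣD, no (EM_I) hypothesis left).

WHAT IS NEW.  tempered-d1's `ClassicalResponse.emi_of_kmax_le` (p554899) gives (EM_I) for BOUNDED cutoffs `kmax β R ≤ k₀` with `B_I = 3072(k₀+1)`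
(the sure bound `|influence| ≤ 1536(kmax+1)`), so a β-uniform budget there forces a β-uniform level count.  Here the level count `K(β)` is
UNBOUNDED (`b^{4K(β)} ≍ β/log β`) and the budget is absolute: the Peierls input (p553454, p559956, p563207) does the work.
HONEST FRAMING: a far-UV rung — `K(β) ≍ ¼·log_b β` of the `≍ β/ln b` levels up to `R ≍ ℓ₁/a(β)`; (split-cl) at cutoff `K(β)` carries all the
remaining content of (RM); the characteristic scales need Bałaban's R-operation on odd tori (OPEN).  The LEAD's unreduced `EMI` (all representatives
`x`) is NOT claimed (seam: FINDING C of note LANE-B-g3).  Nothing of E0′, (split), (GD), NT or the gap; not Clay.  References: folklore (composition).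
-/

set_option autoImplicit false

noncomputable section

open MeasureTheory Filter Topology Finset
open Literature.MathematicalPhysics.QuantumLattice

namespace Summit.QuantumFields.YangMills.Cruxes.UVSeamRec.TemperedResponse

open Summit.QuantumFields.YangMills.Cruxes.OSLegsFromFemtoAndGap.DlrCollarTransfer
open Summit.QuantumFields.YangMills.Cruxes.UVSeamRec.PolymerData
open Summit.QuantumFields.YangMills.Cruxes.UVSeamRec.ClassicalResponse
open Summit.QuantumFields.YangMills.Cruxes.UVSeamRec.PolymerRarity (largeFieldHalf_schedule_farUV)
open Summit.QuantumFields.YangMills.Theorems.OddTorusChessboard (Orient)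

variable {N : ℕ} [NeZero N]

/-- **THE REDUCED (EM_I) IN THE FAR ULTRAVIOLET, UNBOUNDED LEVEL COUNT, ABSOLUTE BUDGET.**  Fundamental Wilson state of `SU(N)` (`N ≥ 1`), block
size `b ≥ 11`, threshold schedule `ε β k ≥ ε₀ > 0`.  There are `K : ℝ → ℕ` with `K β → ∞` and `β₁ ≥ 1` such that for every cutoff schedule
`kmax β R ≤ K β`, all `β ≥ β₁`, every odd torus `2L+1`, every reduced (`|x i c| ≤ L`) cyclically `2R+4`-separated cube family with `1 ≤ R`,
`4R+8 ≤ L`, and every `T`:  `⟨exp(2 Σ_{i∈T} influenceAt 𝔟 ε kmax β R (q i) (x i)∘lift)⟩_{2L+1,β} ≤ exp(6144·e²·#T)`.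
Proof: p554392's engine with the weights of `largeFieldHalf_schedule_farUV` (budget `Σ θ ≤ 1`) and the level-`0` activity `≤ 1` beyond `β₁`
(p555011's `levelZero_activity_eventually_le`); `2·e²·1536·(1+1) = 6144·e²`. [folklore] -/
theorem reducedEMI_farUV (𝔟 : BlockSize) (hb : 11 ≤ 𝔟.b) (ε : ℝ → ℕ → ℝ) {ε₀ : ℝ} (hε₀ : 0 < ε₀) (hε : ∀ β k, ε₀ ≤ ε β k) :
    ∃ (K : ℝ → ℕ) (β₁ : ℝ), Tendsto K atTop atTop ∧ 1 ≤ β₁ ∧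
      ∀ kmax : ℝ → ℕ → ℕ, (∀ β R, kmax β R ≤ K β) →
        ∀ β : ℝ, β₁ ≤ β → ∀ (L n : ℕ) (q : Fin n → Fin 4 × Fin 4) (x : Fin n → (Fin 4 → ℤ)) (R : ℕ),
          1 ≤ R → 4 * R + 8 ≤ L → (∀ i c, |x i c| ≤ (L : ℤ)) →
          (∀ i j : Fin n, i ≠ j → ∃ k : Fin 4,
            (2 * (R : ℤ) + 4) ≤ |((((x i k - x j k : ℤ) : ZMod (2 * L + 1))).valMinAbs : ℤ)|) →
          ∀ T : Finset (Fin n),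
            torusE (Matrix.specialUnitaryGroup (Fin N) ℂ) (fundamentalLatticeRep N) β L
                (fun U => Real.exp (((2 : ℕ) : ℝ) * ∑ i ∈ T, influenceAt (N := N) 𝔟 ε kmax β R (q i) (x i) U)) ≤
              Real.exp (6144 * Real.exp 2 * T.card) := by
  obtain ⟨K₀, D₁, H⟩ := torusE_exp_two_mul_sum_influence_le_of_windowCellLaws (N := N)
  obtain ⟨K, θ, δ, hK, hθ0, hθ1, hδ0, hδθ, hlaw, hsum⟩ := largeFieldHalf_schedule_farUV (N := N) 𝔟 hb ε hε₀ hε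
  have hN : 0 < N := Nat.pos_of_ne_zero (NeZero.ne N)
  obtain ⟨β₀, hβ₀⟩ := levelZero_activity_eventually_le hN hε₀ one_pos ε (fun β => hε β 0) K₀ D₁
  refine ⟨K, max 1 β₀, hK, le_max_left _ _, ?_⟩
  intro kmax hkmax β hβ L n q x R hR hRL hred hsep T
  have hβ1 : 1 ≤ β := (le_max_left _ _).trans hβ
  have hβ0' : β₀ ≤ β := (le_max_right _ _).trans hβ
  have hL : 1 ≤ L := by omega
  -- p554392's engine at `ε β`, `kmax β R`, weights `θ β`, activities `δ β`
  have key := H 𝔟 (ε β) (kmax β R) R L β hβ1 x hR hRL hred hsep (θ β) (δ β) (hθ0 β) (hθ1 β) (hδ0 β) (hδθ β)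
    (fun k hk o A hA hwin => hlaw β hβ1 L hL k hk o A hA hwin) T
  have hint : (fun U : LGConfig 4 (Matrix.specialUnitaryGroup (Fin N) ℂ) =>
      Real.exp (((2 : ℕ) : ℝ) * ∑ i ∈ T, influenceAt (N := N) 𝔟 ε kmax β R (q i) (x i) U)) =
      fun U => Real.exp (((2 : ℕ) : ℝ) * ∑ i ∈ T, influence (N := N) 𝔟 (ε β) (kmax β R) R (x i) U) := by
    funext U; rfl
  rw [hint]
  refine key.trans (Real.exp_le_exp.2 ?_)
  -- the budget: level-0 activity ≤ 1, Σ θ ≤ 1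
  have h0 := hβ₀ β hβ0'
  have h1 := hsum kmax hkmax β hβ1 R
  have hT : (0 : ℝ) ≤ T.card := Nat.cast_nonneg _
  have he : Real.exp (2 * 1) = Real.exp 2 := by norm_num
  rw [he]
  have hsum2 : Real.exp (-(β * ((N : ℝ) * ε β 0)) / Fintype.card (Orient 4) + (K₀ + D₁ * Real.log β) / Fintype.card (Orient 4)) +
      ∑ k ∈ (Finset.range (kmax β R + 1)).filter (fun k => 1 ≤ k), θ β k ≤ 2 := by linarith
  have hpos : 0 ≤ 2 * Real.exp 2 * 1536 * (T.card : ℝ) := by positivity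
  nlinarith [hsum2, hpos, Real.exp_pos 2]

/-- **THE REDUCED (EM_I) IN THE LETTERS OF p556228's `hEMIred`, `SU(2)`.**  For every block size `b ≥ 11` and threshold schedule with a floor
`ε β k ≥ ε₀ > 0` there are `K : ℝ → ℕ` (`K β → ∞`) and `β₁ ≥ 1` such that for every cutoff schedule `kmax β R ≤ K β` and every `ℓ₁` the
hypothesis `hEMIred` of `responseMomentsOdd6SU2_of_splitCl_gaussianDomination_reducedEMI` holds with `B_I = 6144·e²` (the guards
`(q i).1 < (q i).2` and `R·uRec β ≤ ℓ₁` are idle).  HONEST FRAMING: (split-cl) at such a cutoff and (GD) stay OPEN. [folklore] -/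
theorem reducedEMI_farUV_SU2 (𝔟 : BlockSize) (hb : 11 ≤ 𝔟.b) (ε : ℝ → ℕ → ℝ) {ε₀ : ℝ} (hε₀ : 0 < ε₀) (hε : ∀ β k, ε₀ ≤ ε β k) :
    ∃ (K : ℝ → ℕ) (β₁ : ℝ), Tendsto K atTop atTop ∧ 1 ≤ β₁ ∧
      ∀ kmax : ℝ → ℕ → ℕ, (∀ β R, kmax β R ≤ K β) → ∀ ℓ₁ : ℝ,
        ∀ β : ℝ, β₁ ≤ β → ∀ (L n : ℕ) (q : Fin n → Fin 4 × Fin 4) (x : Fin n → (Fin 4 → ℤ)) (R : ℕ),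
          (∀ i, (q i).1 < (q i).2) → 1 ≤ R → (R : ℝ) * Transport.uRec β ≤ ℓ₁ → 4 * R + 8 ≤ L →
          (∀ i c, |x i c| ≤ (L : ℤ)) →
          (∀ i j : Fin n, i ≠ j → ∃ k : Fin 4,
            (2 * (R : ℤ) + 4) ≤ |((((x i k - x j k : ℤ) : ZMod (2 * L + 1))).valMinAbs : ℤ)|) →
          ∀ T : Finset (Fin n),
            torusE (Matrix.specialUnitaryGroup (Fin 2) ℂ) (fundamentalLatticeRep 2) β L
                (fun U => Real.exp (((2 : ℕ) : ℝ) * ∑ i ∈ T, influenceAt (N := 2) 𝔟 ε kmax β R (q i) (x i) U)) ≤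
              Real.exp (6144 * Real.exp 2 * T.card) := by
  obtain ⟨K, β₁, hK, hβ₁, h⟩ := reducedEMI_farUV (N := 2) 𝔟 hb ε hε₀ hε
  exact ⟨K, β₁, hK, hβ₁, fun kmax hkmax _ β hβ L n q x R _ hR _ hRL hred hsep T =>
    h kmax hkmax β hβ L n q x R hR hRL hred hsep T⟩

/-- (split-cl) is monotone in its threshold: raising `β₁` weakens it. -/
theorem splitCl_mono_threshold {𝔟 : BlockSize} {ε : ℝ → ℕ → ℝ} {kmax : ℝ → ℕ → ℕ} {C C₁ A₀ β₁ β₁' ℓ₁ : ℝ}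
    {p : Fin 4 × Fin 4 → ℝ → ℝ} (h : SplitCl 𝔟 ε kmax C C₁ A₀ β₁ ℓ₁ p) (hβ : β₁ ≤ β₁') :
    SplitCl 𝔟 ε kmax C C₁ A₀ β₁' ℓ₁ p :=
  fun β hβ' => h β (hβ.trans hβ')

/-- **THE EXACT RESIDUAL ONCE THE LARGE-FIELD HALF IS DISCHARGED IN THE FAR ULTRAVIOLET: (split-cl) AT A FAR-UV CUTOFF + (GD) ⇒ (RM).**
For every block size `b ≥ 11` and threshold schedule with a floor `ε β k ≥ ε₀ > 0` there is `K : ℝ → ℕ` with `K β → ∞` such that for every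
cutoff schedule `kmax β R ≤ K β`: the LEAD's (split-cl) `SplitCl 𝔟 ε kmax C_s C₁ A₀ β₁ ℓ₁ p` (constants `C_s, C₁ > 0`, `A₀ ≥ 0`, `ℓ₁ > 0`, bounded
`p`) together with (GD) `GaussianDominationSU2` imply `ResponseMomentsOdd6SU2` — p556228's glue with its (EM_I)_red hypothesis supplied by
`reducedEMI_farUV_SU2` (and `β₁` raised to the far-UV threshold).  HONEST FRAMING: NOT a recommendation — (split-cl) at cutoff
`K(β) ≍ ¼log_b β ≪ log_b R` asks the classical carrier to absorb every large field between scales `b^{K(β)}` and `R` (tempered-d1's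
OBJECTION-top-scale, evidence #41, argues exactly these matter); the theorem only records WHERE the content of (RM) sits after lane B's rung.
[folklore] -/
theorem responseMomentsOdd6SU2_of_splitClFarUV_gaussianDomination (𝔟 : BlockSize) (hb : 11 ≤ 𝔟.b) (ε : ℝ → ℕ → ℝ) {ε₀ : ℝ}
    (hε₀ : 0 < ε₀) (hε : ∀ β k, ε₀ ≤ ε β k) :
    ∃ K : ℝ → ℕ, Tendsto K atTop atTop ∧
      ∀ kmax : ℝ → ℕ → ℕ, (∀ β R, kmax β R ≤ K β) →
        ∀ (C_s C₁ A₀ P₀ β₁ ℓ₁ : ℝ) (p : Fin 4 × Fin 4 → ℝ → ℝ),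
          0 < C_s → 0 < C₁ → 0 ≤ A₀ → 0 < ℓ₁ → (∀ q β, |p q β| ≤ P₀) →
          SplitCl 𝔟 ε kmax C_s C₁ A₀ β₁ ℓ₁ p → GaussianDominationSU2 → ResponseMomentsDefs.ResponseMomentsOdd6SU2 := by
  obtain ⟨K, β₁', hK, -, h⟩ := reducedEMI_farUV_SU2 𝔟 hb ε hε₀ hε
  refine ⟨K, hK, fun kmax hkmax C_s C₁ A₀ P₀ β₁ ℓ₁ p hCs hC₁ hA₀ hℓ₁ hp hsplit hGD => ?_⟩
  exact responseMomentsOdd6SU2_of_splitCl_gaussianDomination_reducedEMI 𝔟 ε kmax hCs hC₁ hA₀ hℓ₁ hp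
    (splitCl_mono_threshold hsplit (le_max_left β₁ β₁')) hGD
    (fun β hβ L n q x R hq hR hRu hRL hred hsep T =>
      h kmax hkmax ℓ₁ β ((le_max_right _ _).trans hβ) L n q x R hq hR hRu hRL hred hsep T)

end Summit.QuantumFields.YangMills.Cruxes.UVSeamRec.TemperedResponse

end
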